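import Summits.RiemannHypothesis.RiemannHypothesis.Theorems.WeilFormatCPolyWindowMixedRegroup
import HarnessLib

/-!
# Format C, design C∞: the window Fourier coefficients of monomials as REAL pure-power family sums

Route context: Fourier–Galerkin / Schur-complement certificates of Weil positivity on a window ("format C";
cell memo `run/shared/lean/pub/rh-explicit/rh-explicit-weil-10/KERNEL-LEVER.md` §20; supporting stmt-RiemannHypothesis-0098;
seat rh-explicit-weil-10).  The profile tables of the C∞ door are `V(m,j) = d_m² Re ĉ_m(1f_j)/√(2a)` (even sector) and
`2 Im ĉ_{m+1}(1f_j)/√(2a)` (odd sector), `ĉ_m` the window Fourier coefficient and `f_j` a window polynomial.  The structured tail of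
DoorB (`coupling_majorant_gram_shifted`) needs them expanded EXACTLY over the pure-power families: `V(m,j) = ε(m)Σ_f R(f,j)φ_f(m)`.
From `fourierCoeff_ofReal_pow_eq_sum` (`WeilFormatCWindowCoeffDecay`) and `inv_negI_freq_pow`:

* `fourierCoeff_ofReal_pow_eq_sum_inv_pow` —
  `ĉ_m(x^q) = (−1)^m Σ_{k≤q} (−1)^k q^{(k)} (a^{q−k} − (−a)^{q−k}) (a/(πm))^{k+1} i^{k+1}` (`m ≠ 0`);
* `re_fourierCoeff_ofReal_pow`, `im_fourierCoeff_ofReal_pow` — its real and imaginary parts: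
  `(−1)^m Σ_k (−1)^k q^{(k)} (a^{q−k} − (−a)^{q−k}) (a/(πm))^{k+1} Re(i^{k+1})` (resp. `Im(i^{k+1})`), i.e. finite sums of
  `m^{−(k+1)}` with `m`-free real coefficients;
* `re_I_pow_eq`, `im_I_pow_eq` — `Re(iⁿ)`, `Im(iⁿ)` by `n mod 4`;
* `fourierCoeff_sum_mul_pow` — `ĉ_n(Σ_q c_q x^q) = Σ_q c_q ĉ_n(x^q)` (polynomial profiles monomial by monomial).

Pure algebra; standard axioms; no RH claim.
-/

set_option autoImplicit false
-- `Summit.RiemannHypothesis.RiemannHypothesis.…` is the layout-mandated namespace (summit = problem name).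
set_option linter.dupNamespace false

noncomputable section

open Complex Filter Set MeasureTheory
open scoped Real Topology

namespace Summit.RiemannHypothesis.RiemannHypothesis.Theorems.WeilFormatC

open Literature.NumberTheory.LFunctions Literature.NumberTheory.LFunctions.Yoshida1992

variable {a : ℝ}

/-- **The window Fourier coefficient of `x^q` in inverse powers of `m`** (`a ≠ 0`, `m ≠ 0`):
`ĉ_m(x^q) = (−1)^m Σ_{k≤q} (−1)^k q^{(k)} (a^{q−k} − (−a)^{q−k}) · (a/(πm))^{k+1} · i^{k+1}`. -/
theorem fourierCoeff_ofReal_pow_eq_sum_inv_pow (ha : a ≠ 0) {m : ℤ} (hm : m ≠ 0) (q : ℕ) :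
    Yoshida1992.fourierCoeff a m (fun x : ℝ ↦ ((x : ℂ)) ^ q)
      = (-1 : ℂ) ^ m * ∑ k ∈ Finset.range (q + 1), (-1 : ℂ) ^ k * (q.descFactorial k : ℂ)
          * (((a : ℂ)) ^ (q - k) - (((-a : ℝ) : ℂ)) ^ (q - k)) * ((((a / (π * m)) ^ (k + 1) : ℝ) : ℂ) * I ^ (k + 1)) := by
  rw [fourierCoeff_ofReal_pow_eq_sum ha hm q]
  congr 1
  refine Finset.sum_congr rfl fun k _ ↦ ?_
  have hbase : (I * (π * ((-m : ℤ) : ℝ) / a : ℝ) : ℂ) = -(I * (π * m / a : ℝ)) := by push_cast; ring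
  rw [hbase, div_eq_mul_one_div, inv_negI_freq_pow ha hm k, mul_pow]
  push_cast
  ring

/-- **Real part of `ĉ_m(x^q)`**: `(−1)^m Σ_k (−1)^k q^{(k)} (a^{q−k} − (−a)^{q−k}) (a/(πm))^{k+1} Re(i^{k+1})`. -/
theorem re_fourierCoeff_ofReal_pow (ha : a ≠ 0) {m : ℤ} (hm : m ≠ 0) (q : ℕ) :
    (Yoshida1992.fourierCoeff a m (fun x : ℝ ↦ ((x : ℂ)) ^ q)).re
      = (-1 : ℝ) ^ m * ∑ k ∈ Finset.range (q + 1), (-1 : ℝ) ^ k * (q.descFactorial k : ℝ)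
          * (a ^ (q - k) - (-a) ^ (q - k)) * (a / (π * m)) ^ (k + 1) * (I ^ (k + 1)).re := by
  rw [fourierCoeff_ofReal_pow_eq_sum_inv_pow ha hm q]
  have hsgn : ((-1 : ℂ)) ^ m = (((-1 : ℝ) ^ m : ℝ) : ℂ) := by push_cast; rfl
  rw [hsgn, Complex.re_ofReal_mul, Complex.re_sum]
  congr 1
  refine Finset.sum_congr rfl fun k _ ↦ ?_
  have e : (-1 : ℂ) ^ k * (q.descFactorial k : ℂ) * (((a : ℂ)) ^ (q - k) - (((-a : ℝ) : ℂ)) ^ (q - k))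
      * ((((a / (π * m)) ^ (k + 1) : ℝ) : ℂ) * I ^ (k + 1))
      = (((-1 : ℝ) ^ k * (q.descFactorial k : ℝ) * (a ^ (q - k) - (-a) ^ (q - k)) * (a / (π * m)) ^ (k + 1) : ℝ) : ℂ)
        * I ^ (k + 1) := by
    push_cast; ring
  rw [e, Complex.re_ofReal_mul]

/-- **Imaginary part of `ĉ_m(x^q)`**: `(−1)^m Σ_k (−1)^k q^{(k)} (a^{q−k} − (−a)^{q−k}) (a/(πm))^{k+1} Im(i^{k+1})`. -/
theorem im_fourierCoeff_ofReal_pow (ha : a ≠ 0) {m : ℤ} (hm : m ≠ 0) (q : ℕ) :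
    (Yoshida1992.fourierCoeff a m (fun x : ℝ ↦ ((x : ℂ)) ^ q)).im
      = (-1 : ℝ) ^ m * ∑ k ∈ Finset.range (q + 1), (-1 : ℝ) ^ k * (q.descFactorial k : ℝ)
          * (a ^ (q - k) - (-a) ^ (q - k)) * (a / (π * m)) ^ (k + 1) * (I ^ (k + 1)).im := by
  rw [fourierCoeff_ofReal_pow_eq_sum_inv_pow ha hm q]
  have hsgn : ((-1 : ℂ)) ^ m = (((-1 : ℝ) ^ m : ℝ) : ℂ) := by push_cast; rfl
  rw [hsgn, Complex.im_ofReal_mul, Complex.im_sum]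
  congr 1
  refine Finset.sum_congr rfl fun k _ ↦ ?_
  have e : (-1 : ℂ) ^ k * (q.descFactorial k : ℂ) * (((a : ℂ)) ^ (q - k) - (((-a : ℝ) : ℂ)) ^ (q - k))
      * ((((a / (π * m)) ^ (k + 1) : ℝ) : ℂ) * I ^ (k + 1))
      = (((-1 : ℝ) ^ k * (q.descFactorial k : ℝ) * (a ^ (q - k) - (-a) ^ (q - k)) * (a / (π * m)) ^ (k + 1) : ℝ) : ℂ)
        * I ^ (k + 1) := by
    push_cast; ring
  rw [e, Complex.im_ofReal_mul]

/-! ## The values of `Re(iⁿ)`, `Im(iⁿ)` -/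

/-- `Re(iⁿ)` by `n mod 4`: `1, 0, −1, 0`. -/
theorem re_I_pow_eq (n : ℕ) :
    (I ^ n).re = if n % 4 = 0 then 1 else if n % 4 = 2 then -1 else 0 := by
  have hn : n = 4 * (n / 4) + n % 4 := (Nat.div_add_mod n 4).symm
  have h4 : I ^ 4 = 1 := Complex.I_pow_four
  rw [hn, pow_add, pow_mul, h4, one_pow, one_mul, Nat.mul_add_mod_self_left, Nat.mod_mod]
  have hlt : n % 4 < 4 := Nat.mod_lt _ (by norm_num)
  interval_cases (n % 4) <;> simp [pow_succ, Complex.I_mul_I]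

/-- `Im(iⁿ)` by `n mod 4`: `0, 1, 0, −1`. -/
theorem im_I_pow_eq (n : ℕ) :
    (I ^ n).im = if n % 4 = 1 then 1 else if n % 4 = 3 then -1 else 0 := by
  have hn : n = 4 * (n / 4) + n % 4 := (Nat.div_add_mod n 4).symm
  have h4 : I ^ 4 = 1 := Complex.I_pow_four
  rw [hn, pow_add, pow_mul, h4, one_pow, one_mul, Nat.mul_add_mod_self_left, Nat.mod_mod]
  have hlt : n % 4 < 4 := Nat.mod_lt _ (by norm_num)
  interval_cases (n % 4) <;> simp [pow_succ, Complex.I_mul_I]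

/-! ## Fourier coefficients of polynomial windows, monomial by monomial -/

/-- **Linearity over a finite monomial sum**: for coefficients `c_q : ℂ`,
`ĉ_n(Σ_{q∈s} c_q x^q) = Σ_{q∈s} c_q ĉ_n(x^q)` (each monomial integrand is continuous, hence interval-integrable). -/
theorem fourierCoeff_sum_mul_pow (a : ℝ) (n : ℤ) (s : Finset ℕ) (c : ℕ → ℂ) :
    Yoshida1992.fourierCoeff a n (fun x : ℝ ↦ ∑ q ∈ s, c q * ((x : ℂ)) ^ q)
      = ∑ q ∈ s, c q * Yoshida1992.fourierCoeff a n (fun x : ℝ ↦ ((x : ℂ)) ^ q) := by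
  unfold Yoshida1992.fourierCoeff
  have hint : ∀ q ∈ s, IntervalIntegrable (fun x : ℝ ↦ c q * ((x : ℂ)) ^ q * cexp (-(π * I * n * x / a)))
      MeasureTheory.volume (-a) a := fun q _ ↦
    (Continuous.intervalIntegrable (by fun_prop) _ _)
  rw [← intervalIntegral.integral_finsetSum hint |>.symm.trans (intervalIntegral.integral_congr fun x _ ↦ by
    simp only [Finset.sum_mul])]
  refine Finset.sum_congr rfl fun q _ ↦ ?_
  rw [← intervalIntegral.integral_const_mul]
  exact intervalIntegral.integral_congr fun x _ ↦ by ring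

/-- **Real coefficients**: for real `c_q`, `Re ĉ_n(Σ_q c_q x^q) = Σ_q c_q Re ĉ_n(x^q)` and `Im ĉ_n(Σ_q c_q x^q) = Σ_q c_q Im ĉ_n(x^q)`
(the even/odd profile tables `V(m,j)` of the C∞ door, monomial by monomial). -/
theorem re_im_fourierCoeff_sum_ofReal_mul_pow (a : ℝ) (n : ℤ) (s : Finset ℕ) (c : ℕ → ℝ) :
    (Yoshida1992.fourierCoeff a n (fun x : ℝ ↦ ∑ q ∈ s, (c q : ℂ) * ((x : ℂ)) ^ q)).re
        = ∑ q ∈ s, c q * (Yoshida1992.fourierCoeff a n (fun x : ℝ ↦ ((x : ℂ)) ^ q)).re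
      ∧ (Yoshida1992.fourierCoeff a n (fun x : ℝ ↦ ∑ q ∈ s, (c q : ℂ) * ((x : ℂ)) ^ q)).im
        = ∑ q ∈ s, c q * (Yoshida1992.fourierCoeff a n (fun x : ℝ ↦ ((x : ℂ)) ^ q)).im := by
  rw [fourierCoeff_sum_mul_pow a n s (fun q ↦ (c q : ℂ)), Complex.re_sum, Complex.im_sum]
  exact ⟨Finset.sum_congr rfl fun q _ ↦ Complex.re_ofReal_mul _ _,
    Finset.sum_congr rfl fun q _ ↦ Complex.im_ofReal_mul _ _⟩

-- Build note (lead ruling R14-3 append remedy, 2026-08-24): re-landed with byte-identical declarations to trigger the hub olean build.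
end Summit.RiemannHypothesis.RiemannHypothesis.Theorems.WeilFormatC
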